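import Literature.Computability.Complexity.ExtMonotoneCircuits
import Mathlib.Algebra.Group.Subgroup.Basic
import Mathlib.Data.ZMod.Defs
import Mathlib.Data.Matrix.Mul
import HarnessLib

/-!
# Route ConvexRankGates, crux `Capture` (stmt-PneNP-2659): the CSP spine (definitions)

Objects posited by the line `csp-spine-meet-to-join` for the crux
`Summit.PneNP.PneNP.Theses.ConvexRankGates.Capture` (skeleton
`Summits/PneNP/PneNP/Cruxes/Capture/Lines/csp-spine-meet-to-join.lean`, whose registered stubs
`stub_consistencyUnrolls`, `stub_cyclicFredholm`, `stub_cosetMeetToJoinAbelian`,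
`stub_cosetMeetToJoinNonabelian`, `stub_captureModSpine` are stated in exactly this vocabulary and
namespace, so that the stub files `ConvexRankGatesCapture*.lean` can import it):

* `KInconsistent` — `k`-consistency refutation of a SELECTED CSP instance (Feder–Vardi 1998 §5,
  Kolaitis–Vardi 2000), with `mono_sel` (monotone in the selection), `sound`, `unsat`;
* the three solved strata of the CSP dichotomy as monotone wide-gate classes with size parameter
  `s`: `IsLCGate` (local consistency), `IsLinGate` (affine over `ZMod m`, `m ≤ s`), `IsCosetGate`
  (coset constraints over a finite group of order `≤ s`) and its split `IsAbelianCosetGate` /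
  `IsNonabelianCosetGate` (`isCosetGate_cases`), each with its `.monotone` lemma;
* the bases `spineGate s = extGate s ∪ LC_s ∪ LIN_s ∪ COSET_s`, `monConst = {∧₂, ∨₂, 1, 0}`,
  `permBasis S = monConst ∪ PERM_S`, with `extGate_subset_spineGate`, `spineGate_monotone`,
  `isConvGate_const`, `monConst_subset_extGate`, `permBasis_subset_extGate`;

Definitions and their elementary closure properties only — the stub STATEMENTS (explicit signatures
over this vocabulary), the stubs and the composition `Capture_of` live in the skeleton and land as
`ConvexRankGatesCapture*.lean`.
Sources: Feder–Vardi, SIAM J. Comput. 28 (1998) §5–6; Kolaitis–Vardi, JCSS 61 (2000);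
Barto–Kozik, J. ACM 61 (2014); Bulatov–Dalmau, SIAM J. Comput. 36 (2006); the line card
`Cruxes/Capture/Lines/csp-spine-meet-to-join.md`. Lead reshape 2026-08-16 (Stub 3 split by
commutativity of `G`).
-/

namespace Summit.PneNP.PneNP.Cruxes.Capture.CspSpineMeetToJoin

set_option linter.dupNamespace false -- `Summit.PneNP.PneNP.…`: summit = sub-problem (D-0017)

open scoped Matrix
open Literature.Computability.Complexity

/-! ## The three solved strata of the CSP dichotomy as monotone gate classes -/

section LC

variable {nv nd k m : ℕ}

/-- **`k`-consistency refutation** (strong `k`-consistency / the existential `k`-pebble game,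
Feder–Vardi 1998 §5, Kolaitis–Vardi 2000): CSP variables `Fin nv`, domain `Fin nd`; constraint
`j` has scope `U j` and allowed set `R j` (a predicate on total assignments depending only on
`U j`), and is PRESENT iff `v j = true`. `KInconsistent U R v W h` says that the partial assignment
`h|_W` (`|W| ≤ k`; total functions represent partial ones) is derivably inconsistent: it violates a
present constraint inside `W` (`viol`), or some further variable admits no consistent value
(`ext`), or it extends an inconsistent sub-assignment (`mono`); `congr` makes the representative
irrelevant. The selected instance is REFUTED iff the empty assignment is inconsistent. -/
inductive KInconsistent (nv nd k : ℕ) {m : ℕ} (U : Fin m → Finset (Fin nv))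
    (R : Fin m → (Fin nv → Fin nd) → Prop) (v : Fin m → Bool) :
    Finset (Fin nv) → (Fin nv → Fin nd) → Prop
  | viol {j : Fin m} {W : Finset (Fin nv)} {h : Fin nv → Fin nd} :
      v j = true → U j ⊆ W → W.card ≤ k → ¬ R j h → KInconsistent nv nd k U R v W h
  | ext {W : Finset (Fin nv)} {h : Fin nv → Fin nd} (x : Fin nv) :
      W.card < k → x ∉ W →
      (∀ a : Fin nd, KInconsistent nv nd k U R v (insert x W) (Function.update h x a)) →
      KInconsistent nv nd k U R v W h
  | mono {W W' : Finset (Fin nv)} {h : Fin nv → Fin nd} :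
      W ⊆ W' → W'.card ≤ k → KInconsistent nv nd k U R v W h → KInconsistent nv nd k U R v W' h
  | congr {W : Finset (Fin nv)} {h h' : Fin nv → Fin nd} :
      (∀ y ∈ W, h' y = h y) → KInconsistent nv nd k U R v W h → KInconsistent nv nd k U R v W h'

/-- `k`-consistency refutation is MONOTONE in the set of present constraints. -/
theorem KInconsistent.mono_sel {U : Fin m → Finset (Fin nv)} {R : Fin m → (Fin nv → Fin nd) → Prop}
    {v w : Fin m → Bool} (hvw : v ≤ w) {W : Finset (Fin nv)} {h : Fin nv → Fin nd}
    (hd : KInconsistent nv nd k U R v W h) : KInconsistent nv nd k U R w W h := by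
  induction hd with
  | viol hv hU hW hR => exact .viol (eq_true_of_le_of_eq_true (hvw _) hv) hU hW hR
  | ext x hW hx _ ih => exact .ext x hW hx ih
  | mono hWW' hW' _ ih => exact .mono hWW' hW' ih
  | congr hh' _ ih => exact .congr hh' ih

/-- **Soundness**: if the allowed sets are scope-determined and `sol` satisfies every present
constraint, then no partial assignment agreeing with `sol` is derivably inconsistent. In particular
a refuted instance has no solution (completeness holds iff the template has width `k` —
Feder–Vardi 1998, Barto–Kozik 2014; not needed here). -/
theorem KInconsistent.sound {U : Fin m → Finset (Fin nv)} {R : Fin m → (Fin nv → Fin nd) → Prop}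
    (hR : ∀ j h h', (∀ y ∈ U j, h' y = h y) → (R j h ↔ R j h')) {v : Fin m → Bool}
    {sol : Fin nv → Fin nd} (hsol : ∀ j, v j = true → R j sol) {W : Finset (Fin nv)}
    {h : Fin nv → Fin nd} (hd : KInconsistent nv nd k U R v W h) :
    (∀ y ∈ W, sol y = h y) → False := by
  induction hd with
  | @viol j W h hv hU hW hRj =>
    intro hag
    exact hRj ((hR j h sol fun y hy => hag y (hU hy)).2 (hsol j hv))
  | @ext W h x hW hx _ ih =>
    intro hag
    refine ih (sol x) fun y hy => ?_
    rcases Finset.mem_insert.1 hy with rfl | hy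
    · simp
    · rw [Function.update_of_ne (fun hxy : y = x => hx (hxy ▸ hy))]
      exact hag y hy
  | mono hWW' _ _ ih => exact fun hag => ih fun y hy => hag y (hWW' hy)
  | congr hh' _ ih => exact fun hag => ih fun y hy => (hag y hy).trans (hh' y hy)

/-- A refuted selected instance (empty assignment inconsistent) has no solution. -/
theorem KInconsistent.unsat {U : Fin m → Finset (Fin nv)} {R : Fin m → (Fin nv → Fin nd) → Prop}
    (hR : ∀ j h h', (∀ y ∈ U j, h' y = h y) → (R j h ↔ R j h')) {v : Fin m → Bool}
    (href : ∀ h, KInconsistent nv nd k U R v ∅ h) :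
    ¬ ∃ sol : Fin nv → Fin nd, ∀ j, v j = true → R j sol := by
  rintro ⟨sol, hsol⟩
  exact (href sol).sound hR hsol fun y hy => absurd hy (Finset.notMem_empty y)

end LC

/-- **LC gates** (local-consistency stratum; size parameter `s`): arity `≤ s`; CSP variables
`Fin nv`, domain `Fin nd`, width `k` with `nv, nd ≤ s` and `(nv·nd + 1)^k ≤ s` (a bound on the
number of `k`-bounded partial assignments = Datalog facts); input `j` selects a constraint of scope
`U j` (`|U j| ≤ k`) with scope-determined allowed set `R j`; the gate FIRES iff `k`-consistency
refutes the selected instance. For a template of bounded width and `k` at least its width this IS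
unsatisfiability (Feder–Vardi 1998; Barto–Kozik 2014; the hierarchy collapses to width `(2,3)`,
Barto 2016); in general it is a sound under-approximation (`KInconsistent.unsat`). -/
def IsLCGate (s : ℕ) (g : GateFn) : Prop :=
  g.1 ≤ s ∧ ∃ nv nd k : ℕ, nv ≤ s ∧ nd ≤ s ∧ (nv * nd + 1) ^ k ≤ s ∧
    ∃ (U : Fin g.1 → Finset (Fin nv)) (R : Fin g.1 → (Fin nv → Fin nd) → Prop),
      (∀ j, (U j).card ≤ k) ∧ (∀ j h h', (∀ y ∈ U j, h' y = h y) → (R j h ↔ R j h')) ∧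
      ∀ v : Fin g.1 → Bool, g.2 v = true ↔ ∀ h : Fin nv → Fin nd, KInconsistent nv nd k U R v ∅ h

/-- **LIN gates** (affine stratum over cyclic rings; size parameter `s`): a modulus `0 < m ≤ s`,
a dimension `D ≤ s`, one affine equation `a j ⬝ᵥ y = b j` over `ZMod m` per input; the gate FIRES
iff the SELECTED system is unsolvable. At `m = 2` this is the route's XOR-UNSAT
(`XorUnsatIsOnePermGate`, Goos–Kamath–Robere–Sokolov 2019); for general `m` it is the disprover's
`ThirdDoor.linUnsat m D` (Disproof §4) — here with `m` bounded by the size parameter. -/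
def IsLinGate (s : ℕ) (g : GateFn) : Prop :=
  ∃ m D : ℕ, 0 < m ∧ m ≤ s ∧ D ≤ s ∧ ∃ (a : Fin g.1 → Fin D → ZMod m) (b : Fin g.1 → ZMod m),
    ∀ v : Fin g.1 → Bool, g.2 v = true ↔ ¬ ∃ y : Fin D → ZMod m, ∀ j, v j = true → a j ⬝ᵥ y = b j

/-- **COSET gates** (Mal'tsev / subgroup stratum, Feder–Vardi 1998 §6, Bulatov–Dalmau 2006; size
parameter `s`): a finite group `G` with `|G| ≤ s` (ANY finite group — abelian and nonabelian), CSP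
variables `Fin nv`, `nv ≤ s`, arity `≤ s`; input `j` selects the constraint "the restriction of
`h : Fin nv → G` to the scope of `j` lies in the left coset `c j · H j`" of a subgroup
`H j ≤ G^{r j}` (`|G|^{r j} ≤ s`); the gate FIRES iff the selected constraints have NO common
solution. Monotone; polynomial-time (coset constraints are preserved by the Mal'tsev operation
`x y⁻¹ z`). NB: cosets, not word equations — equations over a fixed nonabelian group are
NP-complete (Goldmann–Russell 2002). -/
def IsCosetGate (s : ℕ) (g : GateFn) : Prop :=
  g.1 ≤ s ∧ ∃ (G : Type) (_ : Group G) (_ : Fintype G) (nv : ℕ), Fintype.card G ≤ s ∧ nv ≤ s ∧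
    ∃ (r : Fin g.1 → ℕ) (scope : (j : Fin g.1) → Fin (r j) → Fin nv)
      (H : (j : Fin g.1) → Subgroup (Fin (r j) → G)) (c : (j : Fin g.1) → Fin (r j) → G),
      (∀ j, Fintype.card G ^ r j ≤ s) ∧
      ∀ v : Fin g.1 → Bool, g.2 v = true ↔
        ¬ ∃ h : Fin nv → G, ∀ j, v j = true → (c j)⁻¹ * (fun i => h (scope j i)) ∈ H j

/-- **Abelian COSET gates** (lead reshape, 2026-08-16): `IsCosetGate` with the group `G` commutative
(stated as `∀ a b, a * b = b * a` over the same `Group G` binder, so that the case split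
`isCosetGate_cases` is instance-free). This half of Stub 3 is TRUE (Pontryagin duality turns
emptiness of an intersection of selected cosets into membership of a nontrivial element of
`1 × μ_e` in the subgroup generated by the selected annihilator graphs — ONE PERM gate per candidate
element, an `∨` of `≤ s` of them). -/
def IsAbelianCosetGate (s : ℕ) (g : GateFn) : Prop :=
  g.1 ≤ s ∧ ∃ (G : Type) (_ : Group G) (_ : Fintype G) (nv : ℕ), (∀ a b : G, a * b = b * a) ∧
    Fintype.card G ≤ s ∧ nv ≤ s ∧
    ∃ (r : Fin g.1 → ℕ) (scope : (j : Fin g.1) → Fin (r j) → Fin nv)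
      (H : (j : Fin g.1) → Subgroup (Fin (r j) → G)) (c : (j : Fin g.1) → Fin (r j) → G),
      (∀ j, Fintype.card G ^ r j ≤ s) ∧
      ∀ v : Fin g.1 → Bool, g.2 v = true ↔
        ¬ ∃ h : Fin nv → G, ∀ j, v j = true → (c j)⁻¹ * (fun i => h (scope j i)) ∈ H j

/-- **Nonabelian COSET gates** (lead reshape, 2026-08-16): `IsCosetGate` with a non-commuting pair in
`G` — the idea's DOOR TEST isolated as its own stub (first cases `S₃`, `Q₈`, `A₅`). -/
def IsNonabelianCosetGate (s : ℕ) (g : GateFn) : Prop :=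
  g.1 ≤ s ∧ ∃ (G : Type) (_ : Group G) (_ : Fintype G) (nv : ℕ), (∃ a b : G, a * b ≠ b * a) ∧
    Fintype.card G ≤ s ∧ nv ≤ s ∧
    ∃ (r : Fin g.1 → ℕ) (scope : (j : Fin g.1) → Fin (r j) → Fin nv)
      (H : (j : Fin g.1) → Subgroup (Fin (r j) → G)) (c : (j : Fin g.1) → Fin (r j) → G),
      (∀ j, Fintype.card G ^ r j ≤ s) ∧
      ∀ v : Fin g.1 → Bool, g.2 v = true ↔
        ¬ ∃ h : Fin nv → G, ∀ j, v j = true → (c j)⁻¹ * (fun i => h (scope j i)) ∈ H j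

/-- Every COSET gate is an abelian or a nonabelian COSET gate (excluded middle on commutativity). -/
theorem isCosetGate_cases {s : ℕ} {g : GateFn} (hg : IsCosetGate s g) :
    IsAbelianCosetGate s g ∨ IsNonabelianCosetGate s g := by
  obtain ⟨h1, G, iG, iF, nv, hG, hnv, r, scope, H, c, hr, hiff⟩ := hg
  by_cases hcomm : ∀ a b : G, a * b = b * a
  · exact Or.inl ⟨h1, G, iG, iF, nv, hcomm, hG, hnv, r, scope, H, c, hr, hiff⟩
  · simp only [not_forall] at hcomm
    obtain ⟨a, b, hab⟩ := hcomm
    exact Or.inr ⟨h1, G, iG, iF, nv, ⟨a, b, hab⟩, hG, hnv, r, scope, H, c, hr, hiff⟩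

/-- Registered sub-goal of the skeleton served by this definitions file (the case split used by
`cosetMeetToJoin_of`): every COSET gate is an abelian or a nonabelian COSET gate. -/
theorem isCosetGate_split : ∀ (s : ℕ) (g : GateFn), IsCosetGate s g →
    IsAbelianCosetGate s g ∨ IsNonabelianCosetGate s g :=
  fun _ _ hg => isCosetGate_cases hg

/-- The **spine basis** `B_s ∪ LC_s ∪ LIN_s ∪ COSET_s`: the extended monotone basis of route
ConvexRankGates with the three solved strata of the CSP dichotomy adjoined as wide gates. -/
def spineGate (s : ℕ) : Set GateFn :=
  extGate s ∪ {g | IsLCGate s g ∨ IsLinGate s g ∨ IsCosetGate s g}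

/-- The small monotone basis with constants `{∧₂, ∨₂, 1, 0}` (target of Stub 1 `stub_consistencyUnrolls`). -/
def monConst : Set GateFn :=
  {GateFn.and 2, GateFn.or 2, GateFn.const true, GateFn.const false}

/-- `{∧₂, ∨₂, 1, 0} ∪ PERM_S` (target of Stubs 2, 3a, 3b). -/
def permBasis (S : ℕ) : Set GateFn :=
  monConst ∪ {g | IsPermGate S g}

/-! ## Elementary closure properties: the spine basis is monotone by syntax; constants are CONV gates -/

/-- LC gates are monotone (more present constraints, more refutations). -/
theorem IsLCGate.monotone {s : ℕ} {g : GateFn} (hg : IsLCGate s g) : Monotone g.2 := by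
  obtain ⟨-, nv, nd, k, -, -, -, U, R, -, -, hiff⟩ := hg
  exact monotone_of_forall_iff hiff fun v w hvw hv h => (hv h).mono_sel hvw

/-- LIN gates are monotone (more equations, fewer solutions). -/
theorem IsLinGate.monotone {s : ℕ} {g : GateFn} (hg : IsLinGate s g) : Monotone g.2 := by
  obtain ⟨m, D, -, -, -, a, b, hiff⟩ := hg
  refine monotone_of_forall_iff hiff fun v w hvw hv ⟨y, hy⟩ => hv ⟨y, fun j hj => ?_⟩
  exact hy j (eq_true_of_le_of_eq_true (hvw j) hj)

/-- COSET gates are monotone (more coset constraints, fewer common solutions). -/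
theorem IsCosetGate.monotone {s : ℕ} {g : GateFn} (hg : IsCosetGate s g) : Monotone g.2 := by
  obtain ⟨-, G, _, _, nv, -, -, r, scope, H, c, -, hiff⟩ := hg
  refine monotone_of_forall_iff hiff fun v w hvw hv ⟨h, hh⟩ => hv ⟨h, fun j hj => ?_⟩
  exact hh j (eq_true_of_le_of_eq_true (hvw j) hj)

/-- `B_s ⊆ spineGate s`. -/
theorem extGate_subset_spineGate (s : ℕ) : extGate s ⊆ spineGate s :=
  Set.subset_union_left

/-- **Every gate of the spine basis computes a monotone Boolean function** — the enlarged model is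
still monotone by syntax. -/
theorem spineGate_monotone {s : ℕ} {g : GateFn} (hg : g ∈ spineGate s) : Monotone g.2 := by
  rcases hg with hg | hg | hg | hg
  · exact extGate_monotone hg
  · exact hg.monotone
  · exact hg.monotone
  · exact hg.monotone

/-- Hence every circuit over the spine basis computes a monotone function. -/
theorem monotone_eval_of_isOver_spineGate {ι : Type*} {s : ℕ} (C : Circuit ι)
    (hC : C.IsOver (spineGate s)) : Monotone C.eval :=
  Circuit.monotone_eval_of_isOver (fun _ hg => spineGate_monotone hg) C hC

/-- The constant gates are CONV gates: `1` with no constraint (`p = q = 0`), `0` with the single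
infeasible constraint `0 ≤ -1` (`p = 1`, `q = 0`) (refuter route-review 12:19Z on the item). -/
theorem isConvGate_const (b : Bool) : IsConvGate 1 (GateFn.const b) := by
  cases b
  · refine ⟨1, 0, le_rfl, fun _ => 0, fun _ => -1, fun _ _ => 0, fun _ _ => le_rfl, fun v => ?_⟩
    show false = true ↔ _
    simp only [Bool.false_eq_true, false_iff, not_exists, not_and, not_forall, not_le]
    intro Y _
    refine ⟨0, ?_⟩
    simp
  · refine ⟨0, 0, zero_le_one, fun _ => 0, fun _ => 0, fun _ _ => 0, fun _ _ => le_rfl, fun v => ?_⟩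
    show true = true ↔ _
    simp only [true_iff]
    exact ⟨0, Matrix.PosSemidef.zero, fun i => i.elim0⟩

/-- `{∧₂, ∨₂, 1, 0} ⊆ B_S` for `1 ≤ S`. -/
theorem monConst_subset_extGate {S : ℕ} (hS : 1 ≤ S) : monConst ⊆ extGate S := by
  intro g hg
  simp only [monConst, Set.mem_insert_iff, Set.mem_singleton_iff] at hg
  rcases hg with rfl | rfl | rfl | rfl
  · exact and_mem_extGate S
  · exact or_mem_extGate S
  · exact ((isConvGate_const true).mono hS).mem_extGate
  · exact ((isConvGate_const false).mono hS).mem_extGate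

/-- `{∧₂, ∨₂, 1, 0} ∪ PERM_S ⊆ B_S` for `1 ≤ S`. -/
theorem permBasis_subset_extGate {S : ℕ} (hS : 1 ≤ S) : permBasis S ⊆ extGate S := by
  rintro g (hg | hg)
  · exact monConst_subset_extGate hS hg
  · exact IsPermGate.mem_extGate hg


end Summit.PneNP.PneNP.Cruxes.Capture.CspSpineMeetToJoin
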